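import Summits.BirchSwinnertonDyer.BirchSwinnertonDyer.Theorems.AlignedTransportAtTwoMainConjectureTransportAlignedAtTwoKilfordCopyKernel
import HarnessLib

/-!
# Crux C1 `MainConjectureTransportAlignedAtTwo` (stmt-BirchSwinnertonDyer-22296), line `birth`, residual (R2) `stub_lamLawKilford` (Kilford stratum):
# COPY ↔ KERNEL, the converse — SAME KERNEL ⟹ SAME COPY, hence `twoTorsionCopy D₁.f = twoTorsionCopy D₂.f ⟺ (same half-class kernel)`
# (width seat att-p3 g16; `--supports 22296`)

THEOREMS ONLY (no `def`, no `sorry`, no named fact). Companion of `…KilfordCopyKernel` (p682187: SAME COPY ⟹ SAME KERNEL). With the same inputs — the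
Hecke-self-adjoint perfect pairing IP on `Λ = periodHomologyHecke N` (tree theorem of cell bsd-wall, hypothesis `hIP` here), a carrier
`J : ModularJacobianGaloisData N ι` (T1), `hnz` for both data (the `μ = 0` theorem in the crux's context) and RANK2 for both newforms (Literature named fact
`finrank_isotypic_periodHomologyHecke_eq_two`, p682676, here in its inline `≤ 2` form) — the two currencies of the cell for «the two curves occupy the same
`ρ̄`-plane of `J₀(N)[𝔪]`» are PROVABLY THE SAME: -imc's COPY currency (`F1Sign2.twoTorsionCopy`, H12 census, `F1Sign2.CopyAlignmentAtTwo`) and the KERNEL /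
PLANE currency of the (R2) capstones and of att-p5 g16's PLANES census (`∀ x ∈ Λ, D₁.jacobiMap [x/2] = 0 ↔ D₂.jacobiMap [x/2] = 0`). BSD is not proved by this;
C1 is not closed by this; nothing here touches the open cross-level (unequal-conductor) statement.

* §1 `exists_torsion_add_smul_of_forall_dvd` (pure algebra, NO rank hypothesis) — `B` perfect & `R`-self-adjoint on a finitely generated `ℤ`-module `M`, `K ≤ M`
  saturated with `I • M ≤ K`: if `B(x, K) ⊆ ℓℤ` then `x ∈ M[I] + ℓM` (lift `B(x,·) mod ℓ` through the free `M/K` to an integral functional, which is `B(x′,·)`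
  with `x′ ∈ M[I]`; then `x − x′ ∈ ℓM` by perfectness).
* §2 **`twoTorsionCopy_subset_of_ker_imp`** — if every half-class killed by `D₂.jacobiMap` is killed by `D₁.jacobiMap`, then `twoTorsionCopy D₁.f ⊆ twoTorsionCopy D₂.f`
  (RANK2 for `D₁.f` only); **`twoTorsionCopy_eq_of_ker_iff`** — SAME KERNEL ⟹ SAME COPY; **`twoTorsionCopy_eq_iff_ker_iff`** — COPY ⟺ KERNEL.

References: Darmon–Diamond–Taylor 1995 §1.6 Lemma 1.38, §1.7 [DarmonDiamondTaylor1995]; Diamond–Shurman 2005 Prop. 6.6.4 [DiamondShurman2005];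
Kilford–Wiese 2008 Question 1.9 [KilfordWiese2008]; Cremona 1997 §2.10 [CremonaAlgorithms1997].
-/

noncomputable section

-- justification: the `Summit.BirchSwinnertonDyer.BirchSwinnertonDyer.…` path repeats a component (route-file convention)
set_option linter.dupNamespace false
set_option autoImplicit false

open scoped MatrixGroups ModularForm NumberField Classical
open CongruenceSubgroup Complex WeierstrassCurve IsDedekindDomain Polynomial Module Function
open Literature.NumberTheory.EllipticCurves Literature.NumberTheory.EllipticCurves.ModularForms
open Literature.NumberTheory.EllipticCurves.Greenberg1999
open Summit.BirchSwinnertonDyer.Rank1Residual.F1Sign2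
open Summit.BirchSwinnertonDyer.BirchSwinnertonDyer.Theorems.AlignedTransportAtTwoDeltaPosJacobian
open Summit.BirchSwinnertonDyer.BirchSwinnertonDyer.Theorems.AlignedTransportAtTwoKilfordCopyKernelAlgebra
open Summit.BirchSwinnertonDyer.BirchSwinnertonDyer.Theorems.AlignedTransportAtTwoKilfordCopyKernel

namespace Summit.BirchSwinnertonDyer.BirchSwinnertonDyer.Theorems.AlignedTransportAtTwoKilfordCopyKernelConverse

/-! ## §1 Pure algebra: `B(x, K) ⊆ ℓℤ ⟹ x ∈ M[I] + ℓM` -/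

section Algebra

variable {R M : Type*} [CommRing R] [AddCommGroup M] [Module R M]

/-- **`(K mod ℓ)^⊥ ⊆ M[I] + ℓM` (no rank hypothesis).** `B` perfect and `R`-self-adjoint on the finitely generated `ℤ`-module `M`, `I • M ≤ K`, `K` saturated: an
`x` with `B(x, k) ∈ ℓℤ` for all `k ∈ K` lies in `M[I] + ℓM`. (`B(x, ·) mod ℓ` descends to the free `M/K`; lift it to an integral functional on `M/K`, which
is `B(x′, ·)` for an `I`-torsion `x′`; then `B(x − x′, ·) ⊆ ℓℤ`, so `x − x′ ∈ ℓM`.) [folklore] -/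
theorem exists_torsion_add_smul_of_forall_dvd [Module.Finite ℤ M] (B : M →+ M →+ ℤ) (hB : Bijective B)
    (hadj : ∀ (t : R) (x y : M), B (t • x) y = B x (t • y))
    {I : Ideal R} (K : Submodule ℤ M) (hIK : ∀ t ∈ I, ∀ y : M, t • y ∈ K)
    (hKsat : ∀ (n : ℤ) (y : M), n ≠ 0 → n • y ∈ K → y ∈ K)
    (ℓ : ℕ) {x : M} (hx : ∀ k ∈ K, (ℓ : ℤ) ∣ B x k) :
    ∃ x' : M, (∀ t ∈ I, t • x' = 0) ∧ ∃ m : M, x = x' + ℓ • m := by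
  classical
  -- `M/K` is torsion-free, hence free of finite rank
  haveI : IsAddTorsionFree (M ⧸ K) := by
    rw [isAddTorsionFree_iff]
    intro n hn q₁ q₂ h
    obtain ⟨m₁, rfl⟩ := K.mkQ_surjective q₁
    obtain ⟨m₂, rfl⟩ := K.mkQ_surjective q₂
    have h' : K.mkQ (n • (m₁ - m₂)) = 0 := by
      rw [map_nsmul, map_sub, nsmul_sub, sub_eq_zero]; exact h
    rw [Submodule.mkQ_apply, Submodule.Quotient.mk_eq_zero, ← Nat.cast_smul_eq_nsmul ℤ] at h'
    exact (Submodule.Quotient.eq K).mpr (hKsat n (m₁ - m₂) (Int.natCast_ne_zero.mpr hn) h')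
  haveI : Module.Finite ℤ (M ⧸ K) := Module.Finite.quotient ℤ K
  haveI : Module.Free ℤ (M ⧸ K) := Module.free_of_finite_type_torsion_free'
  let b := Module.Free.chooseBasis ℤ (M ⧸ K)
  -- a set-theoretic section of `M → M/K` and the integral lift `ψ` of `B(x,·) mod ℓ`
  let s : M ⧸ K → M := Function.surjInv K.mkQ_surjective
  have hs : ∀ q, K.mkQ (s q) = q := Function.surjInv_eq K.mkQ_surjective
  let ψ : Module.Dual ℤ (M ⧸ K) := b.constr ℤ fun i ↦ B x (s (b i))
  have hψb : ∀ i, ψ (b i) = B x (s (b i)) := fun i ↦ by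
    simp only [ψ, Basis.constr_basis]
  -- `δ = (B(x,·) − ψ ∘ mkQ) mod ℓ` vanishes on `K`, descends to `M/K`, vanishes on the basis, hence everywhere
  let δ : M →ₗ[ℤ] ZMod ℓ :=
    ((Int.castAddHom (ZMod ℓ)).comp (B x - ψ.toAddMonoidHom.comp K.mkQ.toAddMonoidHom)).toIntLinearMap
  have hδ : ∀ m : M, δ m = (((B x m - ψ (K.mkQ m) : ℤ)) : ZMod ℓ) := fun m ↦ rfl
  have hδK : K ≤ LinearMap.ker δ := by
    intro k hk
    rw [LinearMap.mem_ker, hδ, Submodule.mkQ_apply, (Submodule.Quotient.mk_eq_zero K).mpr hk, map_zero, sub_zero,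
      ZMod.intCast_zmod_eq_zero_iff_dvd]
    exact hx k hk
  let δ' : M ⧸ K →ₗ[ℤ] ZMod ℓ := K.liftQ δ hδK
  have hδ' : ∀ m : M, δ' (K.mkQ m) = δ m := fun m ↦ rfl
  have hδ'0 : δ' = 0 := by
    refine b.ext fun i ↦ ?_
    rw [LinearMap.zero_apply, ← hs (b i), hδ', hδ, hs, hψb, sub_self, Int.cast_zero]
  have hdvd : ∀ m : M, (ℓ : ℤ) ∣ B x m - ψ (K.mkQ m) := by
    intro m
    rw [← ZMod.intCast_zmod_eq_zero_iff_dvd, ← hδ, ← hδ', hδ'0, LinearMap.zero_apply]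
  -- `ψ ∘ mkQ = B(x′, ·)` with `x′` `I`-torsion
  obtain ⟨x', hx'K, hx'⟩ := exists_forall_apply_mkQ_eq B hB.2 K ψ
  have hx'I : ∀ t ∈ I, t • x' = 0 := fun t ht ↦ smul_eq_zero_of_forall_apply_eq_zero B hB.1 hadj hIK hx'K ht
  -- `x − x′ ∈ ℓM`
  have hdiff : ∀ m : M, (ℓ : ℤ) ∣ B (x - x') m := by
    intro m
    rw [map_sub, AddMonoidHom.sub_apply, hx' m]
    exact hdvd m
  obtain ⟨w, hw⟩ := Literature.Algebra.Module.SocleCosocle.exists_eq_nsmul_of_forall_dvd B hB hdiff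
  exact ⟨x', hx'I, w, by rw [← hw, add_sub_cancel]⟩

end Algebra

/-! ## §2 SAME KERNEL ⟹ SAME COPY, and the equivalence -/

variable {N : ℕ} [NeZero N]

/-- **One-sided: kernel inclusion ⟹ copy inclusion.** IP pairing `B`, carrier `J`, data `D₁, D₂` at level `N` of curves without rational `2`-torsion abscissa,
`D₁.jacobiMap` non-zero on some half-class, RANK2 for `D₁.f`; if every half-class killed by `D₂.jacobiMap` is killed by `D₁.jacobiMap`, then
`twoTorsionCopy D₁.f ⊆ twoTorsionCopy D₂.f`. (For `z ∈ Λ[I₁]` and `k ∈ ker ev_{f₂}`: `D₂.jacobiMap [k/2] = 0`, so `D₁.jacobiMap [k/2] = 0`, so `2 ∣ B(z, k)` by the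
bridge for `D₁`; §1 for `K = ker ev_{f₂}` puts `z` in `Λ[I₂] + 2Λ`, and `[z/2] ∈ twoTorsionCopy f₂`.) [cite: DarmonDiamondTaylor1995, §1.6 Lemma 1.38 and §1.7] -/
theorem twoTorsionCopy_subset_of_ker_imp
    (B : periodHomologyHecke N →+ periodHomologyHecke N →+ ℤ) (hB : Function.Bijective B)
    (hadj : ∀ (t : HeckeRing0 N 2) (x y : periodHomologyHecke N), B (t • x) y = B x (t • y))
    (ι : AlgebraicClosure ℚ →+* ℂ) (J : ModularJacobianGaloisData N ι)
    {W₁ W₂ : WeierstrassCurve ℚ} [W₁.IsElliptic] [W₂.IsElliptic]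
    (D₁ : ModularParametrizationData W₁ N) (D₂ : ModularParametrizationData W₂ N)
    (ht₁ : ∀ x : ℚ, ¬ HasRationalTwoTorsionX W₁ x)
    (hnz₁ : ∃ x ∈ periodHomology N, D₁.jacobiMap (Submodule.Quotient.mk ((2 : ℂ)⁻¹ • x)) ≠ 0)
    (hnz₂ : ∃ x ∈ periodHomology N, D₂.jacobiMap (Submodule.Quotient.mk ((2 : ℂ)⁻¹ • x)) ≠ 0)
    (hR2₁ : Module.finrank ℤ
      ((Submodule.torsionBySet (HeckeRing0 N 2) (periodHomologyHecke N) (heckeAnnihilator D₁.f : Set (HeckeRing0 N 2))).restrictScalars ℤ) ≤ 2)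
    (hker : ∀ x ∈ periodHomology N,
      D₂.jacobiMap (Submodule.Quotient.mk ((2 : ℂ)⁻¹ • x)) = 0 → D₁.jacobiMap (Submodule.Quotient.mk ((2 : ℂ)⁻¹ • x)) = 0) :
    twoTorsionCopy D₁.f ⊆ twoTorsionCopy D₂.f := by
  haveI := moduleFinite_int_periodHomologyHecke N
  haveI := moduleFree_int_periodHomologyHecke N
  have hc₂ := c_ne_zero_of_hnz D₂ hnz₂
  -- the evaluation kernel `K₂ = ker ev_{f₂}` as a saturated `ℤ`-submodule containing `I₂ • Λ`
  let g : periodHomologyHecke N →ₗ[ℤ] D₂.L.lattice :=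
    { toFun := fun y ↦ ⟨(D₂.c : ℂ) * (y : Module.Dual ℂ (CuspForm (Gamma0 N) 2)) D₂.f,
        Summit.BirchSwinnertonDyer.BirchSwinnertonDyer.Theorems.AlignedTransportAtTwoDeltaPosFunctional.maninConstant_mul_eval_mem D₂ y.2⟩
      map_add' := fun y y' ↦ by
        apply Subtype.ext
        simp only [Submodule.coe_add, LinearMap.add_apply, mul_add]
      map_smul' := fun n y ↦ by
        apply Subtype.ext
        simp only [Submodule.coe_smul_of_tower, LinearMap.smul_apply, RingHom.id_apply, zsmul_eq_mul]
        ring }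
  set K : Submodule ℤ (periodHomologyHecke N) := LinearMap.ker g with hKdef
  have hKmem : ∀ y : periodHomologyHecke N, y ∈ K ↔ (y : Module.Dual ℂ (CuspForm (Gamma0 N) 2)) D₂.f = 0 := by
    intro y
    rw [hKdef, LinearMap.mem_ker, ← Subtype.coe_inj]
    change (D₂.c : ℂ) * (y : Module.Dual ℂ (CuspForm (Gamma0 N) 2)) D₂.f = ((0 : D₂.L.lattice) : ℂ) ↔ _
    rw [ZeroMemClass.coe_zero, mul_eq_zero, or_iff_right (Int.cast_ne_zero.mpr hc₂)]
  have hKsat : ∀ (n : ℤ) (y : periodHomologyHecke N), n ≠ 0 → n • y ∈ K → y ∈ K := by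
    intro n y hn hny
    rw [hKmem] at hny ⊢
    rw [Submodule.coe_smul_of_tower, ← Int.cast_smul_eq_zsmul ℂ, LinearMap.smul_apply, smul_eq_mul, mul_eq_zero] at hny
    exact hny.resolve_left (Int.cast_ne_zero.mpr hn)
  have hIK : ∀ t ∈ heckeAnnihilator D₂.f, ∀ y : periodHomologyHecke N, t • y ∈ K := by
    intro t ht y
    rw [hKmem, Submodule.coe_smul, HeckeRing0.smul_dual_apply]
    have : HeckeRing0.toEnd N 2 t D₂.f = 0 := ht
    rw [this, map_zero]
  -- take an element of the first copy
  rintro p ⟨z, hz, rfl⟩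
  let z' : periodHomologyHecke N := ⟨(z : Module.Dual ℂ (CuspForm (Gamma0 N) 2)), z.2⟩
  have hz' : ∀ t ∈ heckeAnnihilator D₁.f, t • z' = 0 := by
    intro t ht
    apply Subtype.ext
    rw [Submodule.coe_smul, Submodule.coe_zero]
    exact hz t ht
  -- `B(z, k)` is even for every `k ∈ K₂`
  have hdvd : ∀ k ∈ K, (2 : ℤ) ∣ B z' k := by
    intro k hk
    have h2 : D₂.jacobiMap (Submodule.Quotient.mk ((2 : ℂ)⁻¹ • (k : Module.Dual ℂ (CuspForm (Gamma0 N) 2)))) = 0 :=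
      jacobiMap_half_eq_zero_of_mem_add_two D₂ (k := k) (z := 0) ((hKmem k).mp hk) (by rw [smul_zero, add_zero])
    have h1 := hker k k.2 h2
    exact (jacobiMap_half_eq_zero_iff_forall_dvd B hB hadj ι J D₁ ht₁ hnz₁ hR2₁ k).mp h1 z' hz'
  -- §1: `z ∈ Λ[I₂] + 2Λ`
  obtain ⟨x', hx'I, m, hzm⟩ := exists_torsion_add_smul_of_forall_dvd B hB hadj K hIK hKsat 2 hdvd
  -- `[z/2] = [x′/2]` and `x′ ∈ Λ[I₂]`
  have hx'mem : (⟨(x' : Module.Dual ℂ (CuspForm (Gamma0 N) 2)), x'.2⟩ : periodHomology N) ∈ isotypicPeriodSublattice D₂.f := by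
    change ∀ t ∈ heckeAnnihilator D₂.f, t • (x' : Module.Dual ℂ (CuspForm (Gamma0 N) 2)) = 0
    intro t ht
    have := hx'I t ht
    rw [← Subtype.coe_inj, Submodule.coe_smul, Submodule.coe_zero] at this
    exact this
  refine ⟨⟨(x' : Module.Dual ℂ (CuspForm (Gamma0 N) 2)), x'.2⟩, hx'mem, ?_⟩
  -- `divMap 2 x′ = divMap 2 z` since `z − x′ = 2m ∈ 2Λ`
  have hzx : (z : Module.Dual ℂ (CuspForm (Gamma0 N) 2)) = (x' : Module.Dual ℂ (CuspForm (Gamma0 N) 2)) +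
      (2 : ℂ) • (m : Module.Dual ℂ (CuspForm (Gamma0 N) 2)) := by
    have h := congrArg (fun v : periodHomologyHecke N ↦ (v : Module.Dual ℂ (CuspForm (Gamma0 N) 2))) hzm
    simp only [Submodule.coe_add, Submodule.coe_smul_of_tower] at h
    rw [← Nat.cast_smul_eq_nsmul ℂ, Nat.cast_ofNat] at h
    exact h
  change Submodule.Quotient.mk (((2 : ℕ) : ℂ)⁻¹ • (x' : Module.Dual ℂ (CuspForm (Gamma0 N) 2))) =
    (Submodule.Quotient.mk (((2 : ℕ) : ℂ)⁻¹ • (z : Module.Dual ℂ (CuspForm (Gamma0 N) 2))) : J0 N)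
  rw [Submodule.Quotient.eq, mem_periodHomologyHecke, hzx, smul_add, smul_smul, Nat.cast_ofNat,
    inv_mul_cancel₀ (two_ne_zero : (2 : ℂ) ≠ 0), one_smul, ← sub_sub, sub_self, zero_sub]
  exact (periodHomology N).neg_mem m.2

/-- **SAME KERNEL ⟹ SAME COPY.** Under IP, a carrier `J`, `hnz` for both data and RANK2 for both newforms: if the two Jacobi maps have the same kernel on the
half-classes `[x/2] ∈ J₀(N)[2]`, then `twoTorsionCopy D₁.f = twoTorsionCopy D₂.f`. [cite: DarmonDiamondTaylor1995, §1.6 Lemma 1.38 and §1.7]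
[cite: KilfordWiese2008, Question 1.9] -/
theorem twoTorsionCopy_eq_of_ker_iff (hIP : periodHomology_exists_heckeSelfAdjoint_perfectPairing)
    (ι : AlgebraicClosure ℚ →+* ℂ) (J : ModularJacobianGaloisData N ι)
    {W₁ W₂ : WeierstrassCurve ℚ} [W₁.IsElliptic] [W₂.IsElliptic]
    (D₁ : ModularParametrizationData W₁ N) (D₂ : ModularParametrizationData W₂ N)
    (ht₁ : ∀ x : ℚ, ¬ HasRationalTwoTorsionX W₁ x) (ht₂ : ∀ x : ℚ, ¬ HasRationalTwoTorsionX W₂ x)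
    (hnz₁ : ∃ x ∈ periodHomology N, D₁.jacobiMap (Submodule.Quotient.mk ((2 : ℂ)⁻¹ • x)) ≠ 0)
    (hnz₂ : ∃ x ∈ periodHomology N, D₂.jacobiMap (Submodule.Quotient.mk ((2 : ℂ)⁻¹ • x)) ≠ 0)
    (hR2₁ : Module.finrank ℤ
      ((Submodule.torsionBySet (HeckeRing0 N 2) (periodHomologyHecke N) (heckeAnnihilator D₁.f : Set (HeckeRing0 N 2))).restrictScalars ℤ) ≤ 2)
    (hR2₂ : Module.finrank ℤ
      ((Submodule.torsionBySet (HeckeRing0 N 2) (periodHomologyHecke N) (heckeAnnihilator D₂.f : Set (HeckeRing0 N 2))).restrictScalars ℤ) ≤ 2)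
    (hker : ∀ x ∈ periodHomology N,
      D₁.jacobiMap (Submodule.Quotient.mk ((2 : ℂ)⁻¹ • x)) = 0 ↔ D₂.jacobiMap (Submodule.Quotient.mk ((2 : ℂ)⁻¹ • x)) = 0) :
    twoTorsionCopy D₁.f = twoTorsionCopy D₂.f := by
  obtain ⟨B, hB, hadj⟩ := hIP N
  exact Set.Subset.antisymm
    (twoTorsionCopy_subset_of_ker_imp B hB hadj ι J D₁ D₂ ht₁ hnz₁ hnz₂ hR2₁ fun x hx h ↦ (hker x hx).mpr h)
    (twoTorsionCopy_subset_of_ker_imp B hB hadj ι J D₂ D₁ ht₂ hnz₂ hnz₁ hR2₂ fun x hx h ↦ (hker x hx).mp h)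

/-- **COPY ⟺ KERNEL.** Under IP, a carrier `J`, `hnz` for both data and RANK2 for both newforms: the cell's two currencies for «the two curves occupy the same
`ρ̄`-plane of `J₀(N)[2]`» coincide — `twoTorsionCopy D₁.f = twoTorsionCopy D₂.f` (-imc's H12 / `CopyAlignmentAtTwo`) iff the two Jacobi maps have the same
half-class kernel (the (R2) capstones' `hker`; att-p5 g16's PLANES). [cite: DarmonDiamondTaylor1995, §1.6 Lemma 1.38 and §1.7] [cite: KilfordWiese2008, Question 1.9] -/
theorem twoTorsionCopy_eq_iff_ker_iff (hIP : periodHomology_exists_heckeSelfAdjoint_perfectPairing)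
    (ι : AlgebraicClosure ℚ →+* ℂ) (J : ModularJacobianGaloisData N ι)
    {W₁ W₂ : WeierstrassCurve ℚ} [W₁.IsElliptic] [W₂.IsElliptic]
    (D₁ : ModularParametrizationData W₁ N) (D₂ : ModularParametrizationData W₂ N)
    (ht₁ : ∀ x : ℚ, ¬ HasRationalTwoTorsionX W₁ x) (ht₂ : ∀ x : ℚ, ¬ HasRationalTwoTorsionX W₂ x)
    (hnz₁ : ∃ x ∈ periodHomology N, D₁.jacobiMap (Submodule.Quotient.mk ((2 : ℂ)⁻¹ • x)) ≠ 0)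
    (hnz₂ : ∃ x ∈ periodHomology N, D₂.jacobiMap (Submodule.Quotient.mk ((2 : ℂ)⁻¹ • x)) ≠ 0)
    (hR2₁ : Module.finrank ℤ
      ((Submodule.torsionBySet (HeckeRing0 N 2) (periodHomologyHecke N) (heckeAnnihilator D₁.f : Set (HeckeRing0 N 2))).restrictScalars ℤ) ≤ 2)
    (hR2₂ : Module.finrank ℤ
      ((Submodule.torsionBySet (HeckeRing0 N 2) (periodHomologyHecke N) (heckeAnnihilator D₂.f : Set (HeckeRing0 N 2))).restrictScalars ℤ) ≤ 2) :
    twoTorsionCopy D₁.f = twoTorsionCopy D₂.f ↔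
      ∀ x ∈ periodHomology N,
        D₁.jacobiMap (Submodule.Quotient.mk ((2 : ℂ)⁻¹ • x)) = 0 ↔ D₂.jacobiMap (Submodule.Quotient.mk ((2 : ℂ)⁻¹ • x)) = 0 :=
  ⟨ker_iff_of_twoTorsionCopy_eq hIP ι J D₁ D₂ ht₁ ht₂ hnz₁ hnz₂ hR2₁ hR2₂,
    twoTorsionCopy_eq_of_ker_iff hIP ι J D₁ D₂ ht₁ ht₂ hnz₁ hnz₂ hR2₁ hR2₂⟩

end Summit.BirchSwinnertonDyer.BirchSwinnertonDyer.Theorems.AlignedTransportAtTwoKilfordCopyKernelConverse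

end
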